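import Summits.PneNP.PneNP.Theses.LatticeMagic
import Summits.PneNP.PneNP.Theses.ProofCplx
import Summits.PneNP.PneNP.Theses.ExpanderLinearGenerators
import Summits.PneNP.PneNP.Theorems.LatticeMagicTargetIffNPneCoNP
import Literature.Computability.Complexity.ProofComplexityNP

/-!
# Route LatticeMagic — the crux `Target` (stmt-PneNP-10709) IS item stmt-PneNP-0097 (`¬ HasPolyBoundedProofSystem TAUT`)

Kernel-checked identification of two open items of the summit `PneNP` as ONE statement:

* `Summit.PneNP.PneNP.Theses.LatticeMagic.Target` (stmt-PneNP-10709: GapCVP_c ∉ PromiseCoNP for some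
  constant `c ≥ 1`) `↔ NP ≠ coNP` — `latticeMagicTarget_iff_NP_ne_coNP`
  (`Theorems/LatticeMagicTargetIffNPneCoNP.lean`; Arora–Babai–Stern–Sweedyk 1997 NP-hardness, discharged in
  the tree, and Aharonov–Regev 2005 App. B);
* `NP ≠ coNP ↔ ¬ HasPolyBoundedProofSystem TAUT` — Cook–Reckhow 1979 Prop. 1.1, discharged in the tree
  (`Literature.Computability.Complexity.NP_eq_coNP_iff_hasPolyBoundedProofSystem_TAUT_holds`; cf.
  `noPolyBoundedProofSystem_iff_NP_ne_coNP` in `Theorems/ExpanderLinearGeneratorsNoPolyBoundedProofSystem.lean`),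
  and `¬ HasPolyBoundedProofSystem TAUT` is VERBATIM the rank-0 item stmt-PneNP-0097 shared by the routes
  ProofCplx (`ProofcplxThesis`), ExpanderLinearGenerators / AperiodicTorus / LyapunovRefutations / MatroidTseitin
  (`NoPolyBoundedProofSystem`).

Hence `Target ↔ ProofcplxThesis ↔ NoPolyBoundedProofSystem`: stmt-PneNP-10709 closes the moment stmt-PneNP-0097
does (`latticeMagicTarget_of_proofcplxThesis`, one line) and not before (the converse, one line) — the
crux of route LatticeMagic is the open problem `NP ≠ coNP` under a lattice name, with no content of its own
for a prover to settle.
-/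

set_option linter.dupNamespace false

namespace Summit.PneNP.PneNP.Theorems

open Literature.Computability.Complexity Literature.Computability.MetaComplexity
open Summit.PneNP.PneNP.Theses.LatticeMagic (Target)
open Summit.PneNP.PneNP.Theses.ProofCplx (ProofcplxThesis)
open Summit.PneNP.PneNP.Theses.ExpanderLinearGenerators (NoPolyBoundedProofSystem)

/-- `Target ↔ ¬ HasPolyBoundedProofSystem TAUT` (through `NP ≠ coNP`: Arora et al. 1997 + Aharonov–Regev
2005 App. B on the lattice side, Cook–Reckhow 1979 Prop. 1.1 on the proof-system side; all discharged in
the tree). [cite: CookReckhow1979, §1 Prop. 1.1] [cite: AroraEtAl1997, Thm. 5 (i)] [cite: AharonovRegev2005, App. B] -/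
theorem latticeMagicTarget_iff_not_hasPolyBoundedProofSystem_TAUT :
    Target ↔ ¬ HasPolyBoundedProofSystem TAUT := by
  have h : Nondeterministic.NP = coNP ↔ HasPolyBoundedProofSystem TAUT :=
    NP_eq_coNP_iff_hasPolyBoundedProofSystem_TAUT_holds
  exact latticeMagicTarget_iff_NP_ne_coNP.trans (not_congr h)

/-- **stmt-PneNP-10709 ↔ stmt-PneNP-0097** (route ProofCplx's spelling `ProofcplxThesis`). [cite: CookReckhow1979, §1 Prop. 1.1] -/
theorem latticeMagicTarget_iff_proofcplxThesis :
    Summit.PneNP.PneNP.Theses.LatticeMagic.Target ↔ Summit.PneNP.PneNP.Theses.ProofCplx.ProofcplxThesis :=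
  latticeMagicTarget_iff_not_hasPolyBoundedProofSystem_TAUT

/-- **stmt-PneNP-10709 ↔ stmt-PneNP-0097** (route ExpanderLinearGenerators' spelling
`NoPolyBoundedProofSystem`). [cite: CookReckhow1979, §1 Prop. 1.1] -/
theorem latticeMagicTarget_iff_noPolyBoundedProofSystem : Target ↔ NoPolyBoundedProofSystem :=
  latticeMagicTarget_iff_not_hasPolyBoundedProofSystem_TAUT

/-- The one-line closure of the crux from stmt-PneNP-0097, for the day that item lands. [folklore] -/
theorem latticeMagicTarget_of_proofcplxThesis (h : ProofcplxThesis) : Target :=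
  latticeMagicTarget_iff_proofcplxThesis.mpr h

/-- … and the converse: a proof of the crux would close stmt-PneNP-0097 (and its four sibling spellings). [folklore] -/
theorem proofcplxThesis_of_latticeMagicTarget (h : Target) : ProofcplxThesis :=
  latticeMagicTarget_iff_proofcplxThesis.mp h

end Summit.PneNP.PneNP.Theorems
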